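import Literature.MathematicalPhysics.QuantumFieldTheory.Balaban1983to89.B11Eq81Expansion
import Literature.MathematicalPhysics.QuantumFieldTheory.Balaban1983to89.B11GlobalMin

/-!
# `Balaban1983to89.B11Eq142LocalMin` — T. Bałaban, *The variational problem and background fields in renormalization group method
# for lattice gauge theories*, Commun. Math. Phys. **102** (1985) 277–309 [Balaban1985Variational]: the MINIMALITY SENTENCE of p. 299,
# (141)–(142) «A second order differential at A′ = 0 is given by the quadratic form above, and it is positive definite. Hence A′ = 0 is a
# minimum of the functional» PROVED on the abstract chart of Sects. D–E (theorem-only where possible; one-norm model)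

statement-level skeleton of published theorems with citation tags; proofs where landed; nothing here is a claim about the Yang–Mills mass gap

PDF held: `paper:balaban1985-cmp102-variational-background` (journal page = PDF page + 276); p. 299 [PDF 23] read as an image by this seat
(render `run/shared/lean/pub/pub-balaban/b2b-balaban-ref1/pages/1985-cmp102-variational-background/…-p023-x2.png`), pp. 290, 292–293,
296 [PDF 14, 16–17, 20] likewise (this seat, gens 2–7).

CITATION HEADER (lean-in-tree rule 2026-08-18).  WHAT IS REPRODUCED: SKELETON row `B11.Eq141` (reader r08 `ROWS-B11.md`: «(141)–(142)
minimality», decls of record `B11GlobalMin.LocalMinOnChart` = the printed local minimum TYPED AS A HYPOTHESIS SHAPE, and the local → global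
bookkeeping `globalMin_of_chart` modulo the unprinted convexity lemma `ChartConvex`) and the minimality step inside row `B11.Prop7`.
THE PRINT (p. 299 [PDF 23], verbatim): *"It is a critical configuration of the functional (5). To see that U_k is a minimum we apply the
whole procedure with the configuration U_k instead of U₀. We get a functional 𝔉(A′) for which the critical configuration is equal to 0. This
implies that a differential of 𝔉(A′) at A′ = 0 is equal to ⟨δA′, J⟩ and Eq. (93) has the form ⟨δA′, J⟩ = 0 for all δA′ : QδA′ = 0,
RD*δA′ = 0. (141) Further, let us notice that B = 0, hence the configurations A′ satisfy the same conditions as δA′, and we have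
⟨A′, J⟩ = 0. Thus the expansion (81) for this functional has the form 𝔉(A′) = A(U_k) + ½⟨A′, Δ₁A′⟩ + V(A′). (142) A second order
differential at A′ = 0 is given by the quadratic form above, and it is positive definite. Hence A′ = 0 is a minimum of the functional (143)
and this implies that U_k is a minimal configuration of the functional A(U)."* («(143)» is a print slip for (142), cell DIVERGENCE D-B11-5;
«Eq. (93)» for the variational equation (99)/(82).)  INPUTS AS PRINTED: the expansion (81) `𝔉(A′) = A(U₀) + ⟨A′, J⟩ + ½⟨A′, Δ₁A′⟩ + V(A′)`
(tree: `B11Eq127EulerLagrange.functional81`, `B11Eq81Expansion.eq81`), the tangent space (83) {QδA′ = 0, RD*δA′ = 0} (tree: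
`B11Eq81Expansion.tangent83`; here an arbitrary submodule `T`), positive definiteness of ½⟨A′, Δ₁A′⟩ on it ([5] =
[Balaban1985BackgroundPropagators] Thm 3.11 p. 416 extended to Δ₁ by Thm 3.12, tree `B9.Thm311Printed`; cell GAPS G-B11-E5R), and
«V = higher order terms» ((80); Prop. 4 (98) p. 293 «|((δ/δA′)V)(A′)|_{(−3)} ≤ C₄(max{|A′|_{(−1)}, |∇A′|_{(−2)}})²»).

WHAT IS CERTIFIED (kernel, sorry-free; axioms `propext` / `Classical.choice` / `Quot.sound`).
§1 **(142)** `eq142`: under (141) read as «⟨A′, J⟩ = 0 on T», the functional (81) restricted to T IS `A(U_k) + ½⟨A′, Δ₁A′⟩ + V(A′)`.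
§2 **the minimality sentence** `isLocalMinOn_142` / `strictLocalMin_142`: if the quadratic form is positive definite on T in the coercive
   form `γ‖A′‖² ≤ ⟨A′, Δ₁A′⟩` (γ > 0) and V is of third order at 0 (`|V(A′) − V(0)| ≤ K‖A′‖³` for ‖A′‖ < r), then A′ = 0 is a local minimum
   of 𝔉 on T (Mathlib `IsLocalMinOn`), strict on the punctured ball of the explicit radius `ρ = min r (γ/(2K+1))`; hence
   `localMinOnChart_142 : B11GlobalMin.LocalMinOnChart K 𝔉 0` for every chart piece `K ⊆ T` — the hypothesis SHAPE of `B11GlobalMin`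
   DISCHARGED from the printed ingredients in the one-norm reading.
§3 **«V = higher order terms» from Proposition 4's shape** `cubic_of_fderiv_sq`: if V is differentiable on the ball ‖A′‖ < r with
   ‖(δ/δA′)V(A′)‖ ≤ C₄‖A′‖² there ((98) in one norm), then |V(A′) − V(0)| ≤ C₄‖A′‖³ (mean value inequality on the convex ball) — so §2
   applies with K = C₄ (`isLocalMinOn_142_of_prop4`).
§4 **the same step WITHOUT re-centring** (the paper re-centres at U_k «we apply the whole procedure with the configuration U_k instead of U₀»;
   abstractly one may stay at U₀): `isMinOn_of_critical` — if A⋆ ∈ K is (82)-critical (`B11Eq81Expansion.IsCritical82` for the derivative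
   (84)), K − A⋆ ⊆ T, K is star-convex at A⋆ inside a convex region S on which (δ/δA′)V is θ-Lipschitz, and γ > 2θ, then
   𝔉(A′) − 𝔉(A⋆) ≥ (γ/2 − θ)‖A′ − A⋆‖² on K: A⋆ minimises 𝔉 on the WHOLE chart piece K (Mathlib `IsMinOn`), strictly; in particular
   `LocalMinOnChart K 𝔉 A⋆` and the conclusion of `B11GlobalMin.globalMin_on_chart` hold in this one-norm model WITHOUT the convexity
   hypothesis `ChartConvex`.
§5 **«positive definite» ⇒ coercive** on a finite-dimensional tangent space `coercive_of_posDef` (compactness of the unit sphere): the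
   printed words give the §2 hypothesis on every finite lattice.  (Private plumbing: `margin_nonneg`, `taylor_remainder_of_lipschitz` = the
   mean value inequality with the derivative compared to its value at the base point.)

HONEST SCOPE — what is NOT claimed.  (i) ONE abstract real Hilbert norm stands for the paper's family of weighted sup-norms |·|_{(−1)},
|∇·|_{(−2)}, |·|_{(−3)} and for the L² pairing ⟨·,·⟩; in print the smallness θ of (δ²/δA′²)V ((186): block-sup operator bounds) and the
positivity γ of Δ₁ ([5] Thm 3.11: an L² statement) live in DIFFERENT norms, which is exactly the located residual of the GLOBAL reading
(cell GAPS G-B11-E5g, module docstring of `B11GlobalMin`, record ML-SUPPLIED.md): §4 shows the SHAPE of the argument closing it when the two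
norms agree and does NOT discharge (ML) for the lattice norms.  (ii) The LOCAL statement §2 is norm-robust (any γ > 0, any cubic constant)
and is what p. 299 prints.  (iii) Positive definiteness of Δ₁ on T, the expansion (81) and Prop. 4 are hypotheses here (rows B9.Thm3.11,
B11.Eq78, B11.Prop4); nothing of the lattice is constructed.  Mega-formalization `lit-balaban`, HOME `run/shared/lean/pub/lit-balaban/`,
reader/typer seat r08 gen 7 (unit `lit-balaban-r08`).  Imports `B11Eq81Expansion` (→ `B11Eq127EulerLagrange`), `B11GlobalMin`; modifies
nothing.  Net new unproved facts: 0 (theorems only; no `def … : Prop`).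
-/

noncomputable section

open scoped InnerProductSpace
open Set Metric

namespace Literature.MathematicalPhysics.QuantumFieldTheory.Balaban1983to89.B11Eq142LocalMin

open B11Eq127EulerLagrange (functional81)
open B11Eq81Expansion (IsCritical82)
open B11GlobalMin (LocalMinOnChart)

variable {E : Type*} [NormedAddCommGroup E] [InnerProductSpace ℝ E]

/-! ## §1 (141)–(142): the expansion at the re-centred background -/

/-- **(142)** p. 299: under (141) in the form «the configurations A′ satisfy the same conditions as δA′, and we have ⟨A′, J⟩ = 0» (B = 0,
so A′ itself lies in the tangent space T = {QA′ = 0, RD*A′ = 0}), the expansion (81) `𝔉(A′) = A(U_k) + ⟨A′, J⟩ + ½⟨A′, Δ₁A′⟩ + V(A′)`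
reads `𝔉(A′) = A(U_k) + ½⟨A′, Δ₁A′⟩ + V(A′)` on T. [cite: Balaban1985Variational, (141)–(142) p.299] -/
theorem eq142 (c : ℝ) (J : E) (Δ₁ : E →ₗ[ℝ] E) (V : E → ℝ) (T : Submodule ℝ E)
    (h141 : ∀ A ∈ T, ⟪A, J⟫_ℝ = 0) {A : E} (hA : A ∈ T) :
    functional81 c J Δ₁ V A = c + 1 / 2 * ⟪A, Δ₁ A⟫_ℝ + V A := by
  simp only [functional81, h141 A hA, add_zero]

/-- (142) at the critical point itself: `𝔉(0) = A(U_k) + V(0)` (and V(0) = 0 for the higher-order terms (80); kept general).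
[cite: Balaban1985Variational, (142) p.299] -/
theorem eq142_zero (c : ℝ) (J : E) (Δ₁ : E →ₗ[ℝ] E) (V : E → ℝ) :
    functional81 c J Δ₁ V 0 = c + V 0 := by
  simp [functional81]

/-! ## §2 «positive definite … Hence A′ = 0 is a minimum»: strict local minimum on the tangent space -/

/-- The elementary inequality behind p. 299: if `γ‖A′‖² ≤ ⟨A′, Δ₁A′⟩` on T and `|V(A′) − V(0)| ≤ K‖A′‖³`, then for A′ ∈ T
`𝔉(A′) − 𝔉(0) = ½⟨A′, Δ₁A′⟩ + (V(A′) − V(0)) ≥ ½γ‖A′‖² − K‖A′‖³ = (γ/2 − K‖A′‖)‖A′‖²`.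
[cite: Balaban1985Variational, (142) p.299] -/
theorem sub_ge_of_coercive_cubic {c : ℝ} {J : E} {Δ₁ : E →ₗ[ℝ] E} {V : E → ℝ} {T : Submodule ℝ E}
    (h141 : ∀ A ∈ T, ⟪A, J⟫_ℝ = 0) {γ K : ℝ} (hpos : ∀ A ∈ T, γ * ‖A‖ ^ 2 ≤ ⟪A, Δ₁ A⟫_ℝ)
    {A : E} (hA : A ∈ T) (hV : |V A - V 0| ≤ K * ‖A‖ ^ 3) :
    (γ / 2 - K * ‖A‖) * ‖A‖ ^ 2 ≤ functional81 c J Δ₁ V A - functional81 c J Δ₁ V 0 := by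
  rw [eq142 c J Δ₁ V T h141 hA, eq142_zero]
  have h1 := hpos A hA
  have h2 : -(K * ‖A‖ ^ 3) ≤ V A - V 0 := by
    have := neg_abs_le (V A - V 0)
    linarith
  nlinarith [h1, h2]

/-- **The minimality sentence of p. 299, quantitative form.**  For the functional (81)/(142) with ⟨A′, J⟩ = 0 on T (141), Δ₁ positive
definite on T in the coercive form `γ‖A′‖² ≤ ⟨A′, Δ₁A′⟩` (γ > 0; [5] Thm 3.11 for Δ₁ by Thm 3.12) and V of third order at 0
(`|V(A′) − V(0)| ≤ K‖A′‖³` for ‖A′‖ < r): every A′ ∈ T with ‖A′‖ < ρ, `ρ = min r (γ/(2K + 1))`, satisfies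
`𝔉(0) + ½‖A′‖²(γ − 2K‖A′‖) ≤ 𝔉(A′)` — the margin `γ − 2K‖A′‖` being non-negative on that ball (`margin_nonneg`).
[cite: Balaban1985Variational, (141)–(142) p.299] -/
theorem le_of_mem_ball_142 {c : ℝ} {J : E} {Δ₁ : E →ₗ[ℝ] E} {V : E → ℝ} {T : Submodule ℝ E}
    (h141 : ∀ A ∈ T, ⟪A, J⟫_ℝ = 0) {γ K r : ℝ}
    (hpos : ∀ A ∈ T, γ * ‖A‖ ^ 2 ≤ ⟪A, Δ₁ A⟫_ℝ) (hV : ∀ A, ‖A‖ < r → |V A - V 0| ≤ K * ‖A‖ ^ 3)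
    {A : E} (hA : A ∈ T) (hAr : ‖A‖ < min r (γ / (2 * K + 1))) :
    functional81 c J Δ₁ V 0 + ‖A‖ ^ 2 / 2 * (γ - 2 * K * ‖A‖) ≤ functional81 c J Δ₁ V A := by
  have hr : ‖A‖ < r := lt_of_lt_of_le hAr (min_le_left _ _)
  have h := sub_ge_of_coercive_cubic (c := c) h141 hpos hA (hV A hr)
  nlinarith [h]

/-- The margin is non-negative on the ball of radius `γ/(2K + 1)` (for γ > 0, K ≥ 0): `2K‖A′‖ ≤ γ` there. [folklore] -/
private theorem margin_nonneg {γ K t : ℝ} (hK : 0 ≤ K) (ht0 : 0 ≤ t) (ht : t < γ / (2 * K + 1)) :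
    0 ≤ γ - 2 * K * t := by
  have h2K1 : 0 < 2 * K + 1 := by linarith
  have h1 : t * (2 * K + 1) < γ := (lt_div_iff₀ h2K1).1 ht
  nlinarith

/-- **p. 299 «Hence A′ = 0 is a minimum» — as Mathlib's `IsLocalMinOn` on the tangent space T.**  Hypotheses as in
`le_of_mem_ball_142` with γ > 0. [cite: Balaban1985Variational, (141)–(142) p.299] -/
theorem isLocalMinOn_142 {c : ℝ} {J : E} {Δ₁ : E →ₗ[ℝ] E} {V : E → ℝ} {T : Submodule ℝ E}
    (h141 : ∀ A ∈ T, ⟪A, J⟫_ℝ = 0) {γ K r : ℝ} (hγ : 0 < γ) (hK : 0 ≤ K) (hr : 0 < r)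
    (hpos : ∀ A ∈ T, γ * ‖A‖ ^ 2 ≤ ⟪A, Δ₁ A⟫_ℝ) (hV : ∀ A, ‖A‖ < r → |V A - V 0| ≤ K * ‖A‖ ^ 3) :
    IsLocalMinOn (functional81 c J Δ₁ V) (T : Set E) 0 := by
  have hρ : 0 < min r (γ / (2 * K + 1)) := lt_min hr (div_pos hγ (by linarith))
  have hmem : (T : Set E) ∩ ball (0 : E) (min r (γ / (2 * K + 1))) ∈ nhdsWithin (0 : E) (T : Set E) :=
    inter_mem_nhdsWithin _ (ball_mem_nhds _ hρ)
  refine Filter.mem_of_superset hmem ?_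
  intro A hA
  obtain ⟨hAT, hAb⟩ := hA
  rw [mem_ball, dist_zero_right] at hAb
  have h := le_of_mem_ball_142 (c := c) h141 hpos hV hAT hAb
  have hm : 0 ≤ γ - 2 * K * ‖A‖ :=
    margin_nonneg hK (norm_nonneg A) (lt_of_lt_of_le hAb (min_le_right _ _))
  show functional81 c J Δ₁ V 0 ≤ functional81 c J Δ₁ V A
  nlinarith [sq_nonneg ‖A‖, h, hm]

/-- **STRICT local minimum** (the «positive definite» content): for A′ ∈ T with `0 < ‖A′‖ < min r (γ/(2K+1))`, `𝔉(0) < 𝔉(A′)`.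
[cite: Balaban1985Variational, (141)–(142) p.299] -/
theorem strictLocalMin_142 {c : ℝ} {J : E} {Δ₁ : E →ₗ[ℝ] E} {V : E → ℝ} {T : Submodule ℝ E}
    (h141 : ∀ A ∈ T, ⟪A, J⟫_ℝ = 0) {γ K r : ℝ} (hK : 0 ≤ K)
    (hpos : ∀ A ∈ T, γ * ‖A‖ ^ 2 ≤ ⟪A, Δ₁ A⟫_ℝ) (hV : ∀ A, ‖A‖ < r → |V A - V 0| ≤ K * ‖A‖ ^ 3)
    {A : E} (hA : A ∈ T) (hA0 : A ≠ 0) (hAr : ‖A‖ < min r (γ / (2 * K + 1))) :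
    functional81 c J Δ₁ V 0 < functional81 c J Δ₁ V A := by
  have h := le_of_mem_ball_142 (c := c) h141 hpos hV hA hAr
  have hn : 0 < ‖A‖ := norm_pos_iff.2 hA0
  have h2K1 : 0 < 2 * K + 1 := by linarith
  have ht : ‖A‖ * (2 * K + 1) < γ := (lt_div_iff₀ h2K1).1 (lt_of_lt_of_le hAr (min_le_right _ _))
  have hm : 0 < γ - 2 * K * ‖A‖ := by nlinarith
  have : 0 < ‖A‖ ^ 2 / 2 * (γ - 2 * K * ‖A‖) := by positivity
  linarith

/-- **The hypothesis SHAPE of `B11GlobalMin` DISCHARGED**: for every chart piece `K` contained in the tangent space (in print K = {(75) with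
B = 0, (76), (77)} ⊆ T at the re-centred background), A′ = 0 is a local minimum of 𝔉 on K — `B11GlobalMin.LocalMinOnChart K 𝔉 0` — from the
printed ingredients (141), (142), positive definiteness and third-order V. [cite: Balaban1985Variational, (141)–(142) p.299] -/
theorem localMinOnChart_142 {c : ℝ} {J : E} {Δ₁ : E →ₗ[ℝ] E} {V : E → ℝ} {T : Submodule ℝ E}
    (h141 : ∀ A ∈ T, ⟪A, J⟫_ℝ = 0) {γ K r : ℝ} (hγ : 0 < γ) (hK : 0 ≤ K) (hr : 0 < r)
    (hpos : ∀ A ∈ T, γ * ‖A‖ ^ 2 ≤ ⟪A, Δ₁ A⟫_ℝ) (hV : ∀ A, ‖A‖ < r → |V A - V 0| ≤ K * ‖A‖ ^ 3)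
    {K' : Set E} (hK' : K' ⊆ (T : Set E)) :
    LocalMinOnChart K' (functional81 c J Δ₁ V) 0 :=
  (isLocalMinOn_142 (c := c) h141 hγ hK hr hpos hV).on_subset hK'

/-! ## §3 «V = higher order terms»: the cubic bound from Proposition 4's derivative bound (98) -/

/-- **Third order from (98)** (one-norm reading of Prop. 4: «|((δ/δA′)V)(A′)|_{(−3)} ≤ C₄(max{|A′|_{(−1)}, |∇A′|_{(−2)}})²»): if V has a
Fréchet derivative `DV A′` at every point of the open ball ‖A′‖ < r with ‖DV A′‖ ≤ C₄‖A′‖², then `|V(A′) − V(0)| ≤ C₄‖A′‖³` on that ball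
(mean value inequality on the convex ball of radius ‖A′‖). [cite: Balaban1985Variational, Prop. 4 (98) p.293] -/
theorem cubic_of_fderiv_sq {V : E → ℝ} {DV : E → E →L[ℝ] ℝ} {C₄ r : ℝ} (hC₄ : 0 ≤ C₄)
    (hV : ∀ A, ‖A‖ < r → HasFDerivAt V (DV A) A) (hDV : ∀ A, ‖A‖ < r → ‖DV A‖ ≤ C₄ * ‖A‖ ^ 2)
    (A : E) (hA : ‖A‖ < r) : |V A - V 0| ≤ C₄ * ‖A‖ ^ 3 := by
  -- work on the closed ball of radius ‖A‖ (convex, inside the open ball of radius r)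
  have hsub : ∀ x ∈ closedBall (0 : E) ‖A‖, ‖x‖ < r := by
    intro x hx
    rw [mem_closedBall, dist_zero_right] at hx
    exact lt_of_le_of_lt hx hA
  have hder : ∀ x ∈ closedBall (0 : E) ‖A‖, HasFDerivWithinAt V (DV x) (closedBall (0 : E) ‖A‖) x :=
    fun x hx => (hV x (hsub x hx)).hasFDerivWithinAt
  have hbound : ∀ x ∈ closedBall (0 : E) ‖A‖, ‖DV x‖ ≤ C₄ * ‖A‖ ^ 2 := by
    intro x hx
    have hx' := hx
    rw [mem_closedBall, dist_zero_right] at hx'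
    refine le_trans (hDV x (hsub x hx)) ?_
    exact mul_le_mul_of_nonneg_left (pow_le_pow_left₀ (norm_nonneg x) hx' 2) hC₄
  have h := (convex_closedBall (0 : E) ‖A‖).norm_image_sub_le_of_norm_hasFDerivWithin_le hder hbound
    (mem_closedBall_self (norm_nonneg A)) (by simp : A ∈ closedBall (0 : E) ‖A‖)
  rw [sub_zero] at h
  have : |V A - V 0| = ‖V A - V 0‖ := (Real.norm_eq_abs _).symm
  rw [this]
  calc ‖V A - V 0‖ ≤ C₄ * ‖A‖ ^ 2 * ‖A‖ := h
    _ = C₄ * ‖A‖ ^ 3 := by ring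

/-- §2 fed by §3: the local minimum at A′ = 0 on T from (141), positive definiteness of Δ₁ on T, and the Prop-4 shape
«‖(δ/δA′)V(A′)‖ ≤ C₄‖A′‖² on ‖A′‖ < r». [cite: Balaban1985Variational, (141)–(142) p.299; Prop. 4 (98) p.293] -/
theorem isLocalMinOn_142_of_prop4 {c : ℝ} {J : E} {Δ₁ : E →ₗ[ℝ] E} {V : E → ℝ} {T : Submodule ℝ E}
    (h141 : ∀ A ∈ T, ⟪A, J⟫_ℝ = 0) {γ C₄ r : ℝ} (hγ : 0 < γ) (hC₄ : 0 ≤ C₄) (hr : 0 < r)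
    (hpos : ∀ A ∈ T, γ * ‖A‖ ^ 2 ≤ ⟪A, Δ₁ A⟫_ℝ) {DV : E → E →L[ℝ] ℝ}
    (hV : ∀ A, ‖A‖ < r → HasFDerivAt V (DV A) A) (hDV : ∀ A, ‖A‖ < r → ‖DV A‖ ≤ C₄ * ‖A‖ ^ 2) :
    IsLocalMinOn (functional81 c J Δ₁ V) (T : Set E) 0 :=
  isLocalMinOn_142 (c := c) h141 hγ hC₄ hr hpos (fun A hA => cubic_of_fderiv_sq hC₄ hV hDV A hA)

/-! ## §4 The same step without re-centring: a critical point of (82) with gap γ > 2θ minimises 𝔉 on the whole chart piece -/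

/-- The algebra of (81) around an arbitrary point: for symmetric Δ₁ and `A′ = A⋆ + W`,
`𝔉(A′) − 𝔉(A⋆) = (⟨W, J⟩ + ⟨W, Δ₁A⋆⟩ + DV W) + ½⟨W, Δ₁W⟩ + (V(A′) − V(A⋆) − DV W)` for ANY linear functional DV (the first bracket is
the derivative (84) applied to W). [cite: Balaban1985Variational, (81), (84) p.290] -/
theorem functional81_sub_eq (c : ℝ) (J : E) {Δ₁ : E →ₗ[ℝ] E} (hΔ : ∀ x y, ⟪Δ₁ x, y⟫_ℝ = ⟪x, Δ₁ y⟫_ℝ)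
    (V : E → ℝ) (DV : E →L[ℝ] ℝ) (Astar W : E) :
    functional81 c J Δ₁ V (Astar + W) - functional81 c J Δ₁ V Astar =
      (⟪W, J⟫_ℝ + ⟪W, Δ₁ Astar⟫_ℝ + DV W) + 1 / 2 * ⟪W, Δ₁ W⟫_ℝ + (V (Astar + W) - V Astar - DV W) := by
  simp only [functional81, map_add, inner_add_left, inner_add_right]
  have h1 : ⟪Astar, Δ₁ W⟫_ℝ = ⟪W, Δ₁ Astar⟫_ℝ := by rw [← hΔ Astar W, real_inner_comm]
  rw [h1]
  ring

/-- The Taylor remainder of V along a segment from a θ-Lipschitz derivative: if V has derivative `DV x` within the convex set S at every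
x ∈ S and `‖DV x − DV A⋆‖ ≤ θ‖x − A⋆‖` on S, then for A′ ∈ S, `|V(A′) − V(A⋆) − DV A⋆ (A′ − A⋆)| ≤ θ‖A′ − A⋆‖²` (Mathlib's mean value
inequality with the derivative compared to `DV A⋆`, on `S ∩ closedBall A⋆ ‖A′ − A⋆‖`). [folklore] -/
private theorem taylor_remainder_of_lipschitz {V : E → ℝ} {DV : E → E →L[ℝ] ℝ} {S : Set E} (hS : Convex ℝ S) {θ : ℝ} (hθ : 0 ≤ θ)
    (hV : ∀ x ∈ S, HasFDerivWithinAt V (DV x) S x) {Astar : E} (hAstar : Astar ∈ S)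
    (hLip : ∀ x ∈ S, ‖DV x - DV Astar‖ ≤ θ * ‖x - Astar‖) {A : E} (hA : A ∈ S) :
    |V A - V Astar - DV Astar (A - Astar)| ≤ θ * ‖A - Astar‖ ^ 2 := by
  set S' : Set E := S ∩ closedBall Astar ‖A - Astar‖ with hS'
  have hS'c : Convex ℝ S' := hS.inter (convex_closedBall _ _)
  have hsub : S' ⊆ S := inter_subset_left
  have hder : ∀ x ∈ S', HasFDerivWithinAt V (DV x) S' x := fun x hx => (hV x (hsub hx)).mono hsub
  have hbound : ∀ x ∈ S', ‖DV x - DV Astar‖ ≤ θ * ‖A - Astar‖ := by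
    intro x hx
    refine le_trans (hLip x (hsub hx)) (mul_le_mul_of_nonneg_left ?_ hθ)
    have := hx.2
    rwa [mem_closedBall, dist_eq_norm] at this
  have hAstar' : Astar ∈ S' := ⟨hAstar, mem_closedBall_self (norm_nonneg _)⟩
  have hA' : A ∈ S' := ⟨hA, by simp [mem_closedBall, dist_eq_norm]⟩
  have h := hS'c.norm_image_sub_le_of_norm_hasFDerivWithin_le' hder hbound hAstar' hA'
  rw [Real.norm_eq_abs] at h
  calc |V A - V Astar - DV Astar (A - Astar)| ≤ θ * ‖A - Astar‖ * ‖A - Astar‖ := h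
    _ = θ * ‖A - Astar‖ ^ 2 := by ring

/-- **Global minimum on a chart piece from criticality + gap** (the p. 299 argument without re-centring, one-norm model).  Let 𝔉 be the
functional (81) with Δ₁ symmetric and positive definite on the tangent space T in the coercive form `γ‖W‖² ≤ ⟨W, Δ₁W⟩`; let S be a convex
region (the ball (77)) on which V is differentiable with a derivative θ-Lipschitz at A⋆ ((186)-type smallness of (δ²/δA′²)V in ONE norm);
let A⋆ ∈ K ⊆ S be (82)-critical for the derivative (84) on T, with K − A⋆ ⊆ T.  If γ ≥ 2θ then `𝔉(A⋆) ≤ 𝔉(A′)` for every A′ ∈ K, with the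
margin `(γ/2 − θ)‖A′ − A⋆‖²`. [cite: Balaban1985Variational, (81)–(84) p.290, (141)–(142) p.299] -/
theorem sub_ge_of_critical (c : ℝ) (J : E) {Δ₁ : E →L[ℝ] E} (hΔ : ∀ x y, ⟪Δ₁ x, y⟫_ℝ = ⟪x, Δ₁ y⟫_ℝ)
    {V : E → ℝ} {DV : E → E →L[ℝ] ℝ} {S K : Set E} (hS : Convex ℝ S) (hKS : K ⊆ S)
    (hV : ∀ x ∈ S, HasFDerivWithinAt V (DV x) S x) {T : Submodule ℝ E} {γ θ : ℝ} (hθ : 0 ≤ θ)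
    (hpos : ∀ W ∈ T, γ * ‖W‖ ^ 2 ≤ ⟪W, Δ₁ W⟫_ℝ) {Astar : E} (hAK : Astar ∈ K)
    (hLip : ∀ x ∈ S, ‖DV x - DV Astar‖ ≤ θ * ‖x - Astar‖) (hKT : ∀ A ∈ K, A - Astar ∈ T)
    (hcrit : IsCritical82 (innerSL ℝ J + innerSL ℝ (Δ₁ Astar) + DV Astar) T) {A : E} (hA : A ∈ K) :
    (γ / 2 - θ) * ‖A - Astar‖ ^ 2 ≤
      functional81 c J (Δ₁ : E →ₗ[ℝ] E) V A - functional81 c J (Δ₁ : E →ₗ[ℝ] E) V Astar := by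
  set W := A - Astar with hW
  have hAW : A = Astar + W := by rw [hW]; abel
  have hWT : W ∈ T := hKT A hA
  have h0 : ⟪W, J⟫_ℝ + ⟪W, Δ₁ Astar⟫_ℝ + DV Astar W = 0 := by
    have := hcrit W hWT
    simpa only [B11Eq81Expansion.hasFDerivAt84_apply] using this
  have hsplit := functional81_sub_eq c J (Δ₁ := (Δ₁ : E →ₗ[ℝ] E)) (fun x y => hΔ x y) V (DV Astar) Astar W
  have hrem := taylor_remainder_of_lipschitz hS hθ hV (hKS hAK) hLip (hKS hA)
  have hrem' : -(θ * ‖W‖ ^ 2) ≤ V A - V Astar - DV Astar W := by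
    have := neg_abs_le (V A - V Astar - DV Astar (A - Astar))
    rw [← hW] at this hrem
    linarith
  have hq := hpos W hWT
  rw [hAW]
  rw [hAW] at hrem'
  simp only [ContinuousLinearMap.coe_coe] at hsplit
  rw [hsplit, h0]
  have : V (Astar + W) - V Astar - (DV Astar) W ≥ -(θ * ‖W‖ ^ 2) := by
    simpa using hrem'
  nlinarith [hq, this]

/-- **`IsMinOn` form** of `sub_ge_of_critical` (γ ≥ 2θ): the critical point minimises 𝔉 over the whole chart piece K — in the one-norm
model the conclusion that `B11GlobalMin.globalMin_on_chart` draws from the unprinted `ChartConvex` holds from criticality + gap alone.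
[cite: Balaban1985Variational, (141)–(142) p.299] -/
theorem isMinOn_of_critical (c : ℝ) (J : E) {Δ₁ : E →L[ℝ] E} (hΔ : ∀ x y, ⟪Δ₁ x, y⟫_ℝ = ⟪x, Δ₁ y⟫_ℝ)
    {V : E → ℝ} {DV : E → E →L[ℝ] ℝ} {S K : Set E} (hS : Convex ℝ S) (hKS : K ⊆ S)
    (hV : ∀ x ∈ S, HasFDerivWithinAt V (DV x) S x) {T : Submodule ℝ E} {γ θ : ℝ} (hθ : 0 ≤ θ) (hγθ : 2 * θ ≤ γ)
    (hpos : ∀ W ∈ T, γ * ‖W‖ ^ 2 ≤ ⟪W, Δ₁ W⟫_ℝ) {Astar : E} (hAK : Astar ∈ K)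
    (hLip : ∀ x ∈ S, ‖DV x - DV Astar‖ ≤ θ * ‖x - Astar‖) (hKT : ∀ A ∈ K, A - Astar ∈ T)
    (hcrit : IsCritical82 (innerSL ℝ J + innerSL ℝ (Δ₁ Astar) + DV Astar) T) :
    IsMinOn (functional81 c J (Δ₁ : E →ₗ[ℝ] E) V) K Astar := by
  intro A hA
  have h := sub_ge_of_critical c J hΔ hS hKS hV hθ hpos hAK hLip hKT hcrit hA
  have : 0 ≤ (γ / 2 - θ) * ‖A - Astar‖ ^ 2 := mul_nonneg (by linarith) (sq_nonneg _)
  show functional81 c J (Δ₁ : E →ₗ[ℝ] E) V Astar ≤ functional81 c J (Δ₁ : E →ₗ[ℝ] E) V A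
  linarith

/-- **Strict form** (γ > 2θ): every other point of the chart piece has strictly larger action — the critical configuration is THE minimum
on K (uniqueness of the minimiser on the chart piece, cf. Prop. 7 «at most one critical orbit»).
[cite: Balaban1985Variational, (141)–(142) p.299; Prop. 7 p.299] -/
theorem lt_of_critical_of_ne (c : ℝ) (J : E) {Δ₁ : E →L[ℝ] E} (hΔ : ∀ x y, ⟪Δ₁ x, y⟫_ℝ = ⟪x, Δ₁ y⟫_ℝ)
    {V : E → ℝ} {DV : E → E →L[ℝ] ℝ} {S K : Set E} (hS : Convex ℝ S) (hKS : K ⊆ S)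
    (hV : ∀ x ∈ S, HasFDerivWithinAt V (DV x) S x) {T : Submodule ℝ E} {γ θ : ℝ} (hθ : 0 ≤ θ) (hγθ : 2 * θ < γ)
    (hpos : ∀ W ∈ T, γ * ‖W‖ ^ 2 ≤ ⟪W, Δ₁ W⟫_ℝ) {Astar : E} (hAK : Astar ∈ K)
    (hLip : ∀ x ∈ S, ‖DV x - DV Astar‖ ≤ θ * ‖x - Astar‖) (hKT : ∀ A ∈ K, A - Astar ∈ T)
    (hcrit : IsCritical82 (innerSL ℝ J + innerSL ℝ (Δ₁ Astar) + DV Astar) T) {A : E} (hA : A ∈ K) (hne : A ≠ Astar) :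
    functional81 c J (Δ₁ : E →ₗ[ℝ] E) V Astar < functional81 c J (Δ₁ : E →ₗ[ℝ] E) V A := by
  have h := sub_ge_of_critical c J hΔ hS hKS hV hθ hpos hAK hLip hKT hcrit hA
  have hn : 0 < ‖A - Astar‖ := norm_pos_iff.2 (sub_ne_zero.2 hne)
  have : 0 < (γ / 2 - θ) * ‖A - Astar‖ ^ 2 := mul_pos (by linarith) (by positivity)
  linarith

/-- Consequences in the vocabulary of `B11GlobalMin`: the local-minimum SHAPE `LocalMinOnChart K 𝔉 A⋆` (from the global one), for the
critical point of a chart piece as in `isMinOn_of_critical`. [cite: Balaban1985Variational, (141)–(142) p.299] -/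
theorem localMinOnChart_of_critical (c : ℝ) (J : E) {Δ₁ : E →L[ℝ] E} (hΔ : ∀ x y, ⟪Δ₁ x, y⟫_ℝ = ⟪x, Δ₁ y⟫_ℝ)
    {V : E → ℝ} {DV : E → E →L[ℝ] ℝ} {S K : Set E} (hS : Convex ℝ S) (hKS : K ⊆ S)
    (hV : ∀ x ∈ S, HasFDerivWithinAt V (DV x) S x) {T : Submodule ℝ E} {γ θ : ℝ} (hθ : 0 ≤ θ) (hγθ : 2 * θ ≤ γ)
    (hpos : ∀ W ∈ T, γ * ‖W‖ ^ 2 ≤ ⟪W, Δ₁ W⟫_ℝ) {Astar : E} (hAK : Astar ∈ K)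
    (hLip : ∀ x ∈ S, ‖DV x - DV Astar‖ ≤ θ * ‖x - Astar‖) (hKT : ∀ A ∈ K, A - Astar ∈ T)
    (hcrit : IsCritical82 (innerSL ℝ J + innerSL ℝ (Δ₁ Astar) + DV Astar) T) :
    LocalMinOnChart K (functional81 c J (Δ₁ : E →ₗ[ℝ] E) V) Astar :=
  (isMinOn_of_critical c J hΔ hS hKS hV hθ hγθ hpos hAK hLip hKT hcrit).localize

/-! ## §5 «positive definite» ⇒ coercive on a finite-dimensional tangent space -/

/-- On a finite-dimensional tangent space T (every lattice of the paper is finite), «the quadratic form ½⟨A′, Δ₁A′⟩ is positive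
definite» (p. 299, the sentence after (142); positivity = [5] Thm 3.11 p. 416 «Δ′_a, G′, (Q′G′²Q′*)⁻¹, Δ_a, G are positive definite»,
for Δ₁ by Thm 3.12) in the pointwise sense `0 < ⟨A′, Δ₁A′⟩` for A′ ∈ T ∖ {0} yields the coercive form `∃ γ > 0, γ‖A′‖² ≤ ⟨A′, Δ₁A′⟩` on T
used in §2 and §4 (minimum of the continuous form on the compact unit sphere of T) — the reading of «positive definite» under which «Hence
A′ = 0 is a minimum» is drawn. [cite: Balaban1985Variational, (142) p.299] -/
theorem coercive_of_posDef (Δ₁ : E →ₗ[ℝ] E) (T : Submodule ℝ E) [FiniteDimensional ℝ T]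
    (hpd : ∀ A ∈ T, A ≠ 0 → 0 < ⟪A, Δ₁ A⟫_ℝ) :
    ∃ γ : ℝ, 0 < γ ∧ ∀ A ∈ T, γ * ‖A‖ ^ 2 ≤ ⟪A, Δ₁ A⟫_ℝ := by
  classical
  -- the form pulled back to the subtype `T`
  let q : T → ℝ := fun x => ⟪(x : E), Δ₁ (x : E)⟫_ℝ
  have hq : Continuous q := by
    have h1 : Continuous fun x : T => (x : E) := continuous_subtype_val
    have h2 : Continuous fun x : T => Δ₁ (x : E) :=
      LinearMap.continuous_of_finiteDimensional (Δ₁ ∘ₗ T.subtype)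
    exact h1.inner h2
  by_cases hne : (sphere (0 : T) 1).Nonempty
  · obtain ⟨x₀, hx₀, hmin⟩ := (isCompact_sphere (0 : T) 1).exists_isMinOn hne hq.continuousOn
    have hx₀1 : ‖(x₀ : E)‖ = 1 := by
      have : ‖x₀‖ = 1 := by simpa using hx₀
      simpa [Submodule.coe_norm] using this
    have hx₀ne : (x₀ : E) ≠ 0 := by
      intro h; rw [h, norm_zero] at hx₀1; exact zero_ne_one hx₀1
    refine ⟨q x₀, hpd _ x₀.2 hx₀ne, fun A hA => ?_⟩
    by_cases hA0 : A = 0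
    · subst hA0; simp
    · have hn : 0 < ‖A‖ := norm_pos_iff.2 hA0
      -- normalise: y = ‖A‖⁻¹ • A lies on the unit sphere of T
      let y : T := ⟨‖A‖⁻¹ • A, T.smul_mem _ hA⟩
      have hy : y ∈ sphere (0 : T) 1 := by
        rw [mem_sphere_zero_iff_norm]
        show ‖(⟨‖A‖⁻¹ • A, _⟩ : T)‖ = 1
        rw [Submodule.coe_norm]
        simp [norm_smul, inv_mul_cancel₀ hn.ne']
      have hle : q x₀ ≤ q y := hmin hy
      have hqy : q y = ‖A‖⁻¹ ^ 2 * ⟪A, Δ₁ A⟫_ℝ := by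
        show ⟪‖A‖⁻¹ • A, Δ₁ (‖A‖⁻¹ • A)⟫_ℝ = _
        rw [map_smul, inner_smul_left, inner_smul_right]
        simp; ring
      rw [hqy] at hle
      have hn2 : 0 < ‖A‖ ^ 2 := by positivity
      have := mul_le_mul_of_nonneg_left hle hn2.le
      calc q x₀ * ‖A‖ ^ 2 = ‖A‖ ^ 2 * q x₀ := by ring
        _ ≤ ‖A‖ ^ 2 * (‖A‖⁻¹ ^ 2 * ⟪A, Δ₁ A⟫_ℝ) := this
        _ = ⟪A, Δ₁ A⟫_ℝ := by field_simp
  · -- the sphere of T is empty: T = {0}, every A ∈ T is 0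
    refine ⟨1, one_pos, fun A hA => ?_⟩
    have hA0 : A = 0 := by
      by_contra h
      have hn : 0 < ‖A‖ := norm_pos_iff.2 h
      apply hne
      refine ⟨⟨‖A‖⁻¹ • A, T.smul_mem _ hA⟩, ?_⟩
      rw [mem_sphere_zero_iff_norm, Submodule.coe_norm]
      simp [norm_smul, inv_mul_cancel₀ hn.ne']
    subst hA0; simp

end Literature.MathematicalPhysics.QuantumFieldTheory.Balaban1983to89.B11Eq142LocalMin
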